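import Summits.QuantumFields.BalabanUV.Beta.GAN24.DressedStepFaceCharges
import Summits.QuantumFields.BalabanUV.Beta.GAN24.BiStencilZeroMode

/-!
# (C)sym at level `j` — THE ff ZERO MODE OF THE DRESSED ONE-STEP SOURCE IS A CELL-AND-LATTICE SUM OF THREE TWO-FACE WORDS
# (blueprint `HOME/b2b-balaban-gan24-formalise-leaf-04/g65/CSYM-LEVEL0-KERNEL-BLUEPRINT.md` §6 (L4), first half: the junction with p2's `zmode N b̃_j`)

WHAT.  p2's one-step charge laws (`T2RecChargeStep.zmode_succ_eq`, `T2RecChargeStepFourFace.zmode_succ_eq_fourFace`) carry the source term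
`zmode N b̃_j (μ,ν;α,β)` with `b̃_j = c • mmRead Lc ∘ K3OfK X̃♮_j Lc S M W + cB • B` (`X̃♮_j = unitK s_f s_m (coDressKBmAt ρ Lc (KInvStep Lc j))`, any localised
first-order tables `S M`, any localised carrier `W`, any border `B` with zero ff block) as ONE symbol.  Here it is opened: by this lineage's two-face read-out
`DressedStepFaceCharges.hasSum_mmRead_K3OfK_dressedStep` ((E0) of the blueprint), cell by cell and bond by bond,
`zmode N b̃_j (μ,ν; inl α, inl β) = c·(−(s_f s_m σ_j)²·Lc²)·Σ_{u ∈ box N} Σ'_{u′} ( FF[(dM_{(μ,u)}∘X̃♮_j)∘dM_{(ν,u′)}] + FF[(dM_{(ν,u′)}∘X̃♮_j)∘dM_{(μ,u)}] − FF[W_{(μ,u)(ν,u′)}] )`,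
`FF[V] = Σ'_{(y,w)} 𝟙f(y_α)𝟙f(w_β)·V y w (inl α)(inl β)`, `σ_j = (Lc^{j+1})^{−(d+2)}` — **`zmode_dressedSource_inl_inl`**; the three words are the DIRECT exchange word
(`EEWordValue` ∕ `EEWordSwap.ee_word_value'` on the `S^E ⊗ S^E` sector at `j = 0`, `N = Lc`), the SWAP exchange word (`EEWordSwap.ee_word_swap_value`) and the `K·W·K` word ((L3), open).
Also **`zmode_dressedSource_inl_inl_of_summable`**: with the three words summable in the lattice bond `u′`, the zero mode splits into the three cell-and-lattice sums.

HONEST: [folklore] `tsum` bookkeeping BY NAME (`Summable.tsum_prod` on the absolutely summable pair family of (E0), `tsum_mul_left`); generic `d`, `j`, `N`, tables and constants;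
asserts NO value of Bałaban's tables; it is the BOOKKEEPING IDENTITY through which pieces (I)–(II) of the level-0 (C_1) balance enter p2's law — nothing of (C)∕(Q-D)∕(Q-D-rate) is
discharged; NEVER «G-an2-4 closed» as (CONV-C); NOT D1, NOT BetaPertH, NOT continuum, NOT Clay.  HONEST DEPENDENCY (verbatim): «continuum YM on T⁴ ⇐ BetaPertH ∧ nine spine
estimates (0/9 proved); BetaPertH ⇐ (D1) ∧ (D4) ∧ CAP+tail; G-an2-4 gates asym, D1 and NE2/3/4.»  G-an2-4 formalisation swarm, leaf prover `b2b-balaban-gan24-formalise-leaf-04`,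
gen 66, 2026-08-23; no existing file touched.
-/

noncomputable section

open Finset
open scoped BigOperators
open Literature.MathematicalPhysics.QuantumFieldTheory
open Literature.MathematicalPhysics.QuantumFieldTheory.Balaban1983to89
open Literature.MathematicalPhysics.QuantumFieldTheory.Balaban1983to89.Beta
open ExpKernelCalculus (Site MKer comp)
open OneStepResolventKernel (Fib)
open OneStepKernelFamily (KInvStep)
open SecondOrderResponse (dM)
open BalabanStepW2 (K3OfK)
open BalabanStepJetsSucc (mmRead)
open AffineAveraging (box toSite)
open Summit.QuantumFields.BalabanUV.Beta.TameKernelCalculus (Loc)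
open Summit.QuantumFields.BalabanUV.Beta.AxialDressingRooted (coDressKBmAt)
open Summit.QuantumFields.BalabanUV.Beta.HessKerDressedUnits (unitK)
open Summit.QuantumFields.BalabanUV.Beta.GAN24.BiStencilZeroMode (Tab zmode)
open Summit.QuantumFields.BalabanUV.Beta.GAN24.DressedStepFaceCharges (hasSum_mmRead_K3OfK_dressedStep)

namespace Summit.QuantumFields.BalabanUV.Beta.GAN24.DressedSourceZeroModeWords

variable {d : ℕ} {Lc : ℕ} [NeZero Lc] {r : Fin (d + 1) → ℕ}

/-- [folklore] **THE ff ZERO MODE OF THE DRESSED ONE-STEP SOURCE, WORD BY WORD** (in-block root `ρ = toSite r`, `1 ≤ Lc`, every level `j`, every period `N`, all units and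
constants; localised `dM` and `W`, a border `B` with zero ff block):
`zmode N (c • mmRead Lc ∘ K3OfK X̃♮_j Lc S M W + cB • B) (μ,ν; inl α, inl β) = c·(−(s_f s_m σ_j)²·Lc²)·Σ_{u ∈ box N} Σ'_{u′} ( FF[(dM_{(μ,u)}∘X̃♮_j)∘dM_{(ν,u′)}] +
FF[(dM_{(ν,u′)}∘X̃♮_j)∘dM_{(μ,u)}] − FF[W_{(μ,u)(ν,u′)}] )` — the border drops (`hBff`), the constant comes out of every `tsum`, and the two leg sums `Σ'_x Σ'_z` of
`zmode` are the pair sum of (E0) `DressedStepFaceCharges.hasSum_mmRead_K3OfK_dressedStep` (`Summable.tsum_prod`). -/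
theorem zmode_dressedSource_inl_inl (hLc : 1 ≤ Lc) (hr : r ∈ box (d + 1) Lc) (sf sm : ℝ) (j : ℕ)
    {S M : Fin (d + 1) → Site (d + 1) → MKer (d + 1) (Fib d)}
    {W : Fin (d + 1) → Site (d + 1) → Fin (d + 1) → Site (d + 1) → MKer (d + 1) (Fib d)} {B : Tab d} (c cB : ℝ)
    (hb : ∀ (κ : Fin (d + 1)) (y : Site (d + 1)), Loc (dM (unitK sf sm (coDressKBmAt (toSite r) Lc (KInvStep (d := d) Lc j))) Lc S M κ y))
    (hW : ∀ (κ : Fin (d + 1)) (y : Site (d + 1)) (κ' : Fin (d + 1)) (y' : Site (d + 1)), Loc (W κ y κ' y'))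
    (hBff : ∀ κ u κ' u' x z (α β : Fin (d + 1)), B κ u κ' u' x z (Sum.inl α) (Sum.inl β) = 0) (N : ℕ) (μ ν α β : Fin (d + 1)) :
    zmode N (fun κ u κ' u' => c • mmRead Lc (K3OfK (unitK sf sm (coDressKBmAt (toSite r) Lc (KInvStep (d := d) Lc j))) Lc S M W κ u κ' u') + cB • B κ u κ' u')
        μ ν (Sum.inl α) (Sum.inl β) =
      c * (-((sf * sm * ((((Lc ^ (j + 1) : ℕ) : ℝ)) ^ (d + 1 + 1))⁻¹) * (sf * sm * ((((Lc ^ (j + 1) : ℕ) : ℝ)) ^ (d + 1 + 1))⁻¹)) * ((Lc : ℝ) * (Lc : ℝ))) *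
        ∑ u ∈ box (d + 1) N, ∑' u' : Site (d + 1),
          ((∑' yw : Site (d + 1) × Site (d + 1),
              (if yw.1 α % (Lc : ℤ) = (Lc : ℤ) - 1 then (1 : ℝ) else 0) * (if yw.2 β % (Lc : ℤ) = (Lc : ℤ) - 1 then (1 : ℝ) else 0) *
              comp (comp (dM (unitK sf sm (coDressKBmAt (toSite r) Lc (KInvStep (d := d) Lc j))) Lc S M μ (toSite u))
                (unitK sf sm (coDressKBmAt (toSite r) Lc (KInvStep (d := d) Lc j))))
                (dM (unitK sf sm (coDressKBmAt (toSite r) Lc (KInvStep (d := d) Lc j))) Lc S M ν u') yw.1 yw.2 (Sum.inl α) (Sum.inl β)) +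
            (∑' yw : Site (d + 1) × Site (d + 1),
              (if yw.1 α % (Lc : ℤ) = (Lc : ℤ) - 1 then (1 : ℝ) else 0) * (if yw.2 β % (Lc : ℤ) = (Lc : ℤ) - 1 then (1 : ℝ) else 0) *
              comp (comp (dM (unitK sf sm (coDressKBmAt (toSite r) Lc (KInvStep (d := d) Lc j))) Lc S M ν u')
                (unitK sf sm (coDressKBmAt (toSite r) Lc (KInvStep (d := d) Lc j))))
                (dM (unitK sf sm (coDressKBmAt (toSite r) Lc (KInvStep (d := d) Lc j))) Lc S M μ (toSite u)) yw.1 yw.2 (Sum.inl α) (Sum.inl β)) -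
            ∑' yw : Site (d + 1) × Site (d + 1),
              (if yw.1 α % (Lc : ℤ) = (Lc : ℤ) - 1 then (1 : ℝ) else 0) * (if yw.2 β % (Lc : ℤ) = (Lc : ℤ) - 1 then (1 : ℝ) else 0) *
              W μ (toSite u) ν u' yw.1 yw.2 (Sum.inl α) (Sum.inl β)) := by
  set X := unitK sf sm (coDressKBmAt (toSite r) Lc (KInvStep (d := d) Lc j)) with hX
  simp only [zmode]
  have hpt : ∀ (u u' x z : Site (d + 1)), (c • mmRead Lc (K3OfK X Lc S M W μ u ν u') + cB • B μ u ν u') x z (Sum.inl α) (Sum.inl β) =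
      c * mmRead Lc (K3OfK X Lc S M W μ u ν u') x z (Sum.inl α) (Sum.inl β) := by
    intro u u' x z
    simp only [Pi.add_apply, Pi.smul_apply, smul_eq_mul, hBff, mul_zero, add_zero]
  simp only [hpt, tsum_mul_left]
  rw [Finset.mul_sum]
  refine Finset.sum_congr rfl fun u _ => ?_
  have key : ∀ u' : Site (d + 1), ∑' x : Site (d + 1), ∑' z : Site (d + 1), mmRead Lc (K3OfK X Lc S M W μ (toSite u) ν u') x z (Sum.inl α) (Sum.inl β) =
      -((sf * sm * ((((Lc ^ (j + 1) : ℕ) : ℝ)) ^ (d + 1 + 1))⁻¹) * (sf * sm * ((((Lc ^ (j + 1) : ℕ) : ℝ)) ^ (d + 1 + 1))⁻¹)) * ((Lc : ℝ) * (Lc : ℝ)) *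
        ((∑' yw : Site (d + 1) × Site (d + 1),
            (if yw.1 α % (Lc : ℤ) = (Lc : ℤ) - 1 then (1 : ℝ) else 0) * (if yw.2 β % (Lc : ℤ) = (Lc : ℤ) - 1 then (1 : ℝ) else 0) *
            comp (comp (dM X Lc S M μ (toSite u)) X) (dM X Lc S M ν u') yw.1 yw.2 (Sum.inl α) (Sum.inl β)) +
          (∑' yw : Site (d + 1) × Site (d + 1),
            (if yw.1 α % (Lc : ℤ) = (Lc : ℤ) - 1 then (1 : ℝ) else 0) * (if yw.2 β % (Lc : ℤ) = (Lc : ℤ) - 1 then (1 : ℝ) else 0) *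
            comp (comp (dM X Lc S M ν u') X) (dM X Lc S M μ (toSite u)) yw.1 yw.2 (Sum.inl α) (Sum.inl β)) -
          ∑' yw : Site (d + 1) × Site (d + 1),
            (if yw.1 α % (Lc : ℤ) = (Lc : ℤ) - 1 then (1 : ℝ) else 0) * (if yw.2 β % (Lc : ℤ) = (Lc : ℤ) - 1 then (1 : ℝ) else 0) *
            W μ (toSite u) ν u' yw.1 yw.2 (Sum.inl α) (Sum.inl β)) := by
    intro u'
    have h := hasSum_mmRead_K3OfK_dressedStep hLc hr sf sm j (hb μ (toSite u)) (hb ν u') (hW μ (toSite u) ν u') α β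
    have e : ∑' x : Site (d + 1), ∑' z : Site (d + 1), mmRead Lc (K3OfK X Lc S M W μ (toSite u) ν u') x z (Sum.inl α) (Sum.inl β) =
        ∑' xz : Site (d + 1) × Site (d + 1), mmRead Lc (K3OfK X Lc S M W μ (toSite u) ν u') xz.1 xz.2 (Sum.inl α) (Sum.inl β) :=
      h.summable.tsum_prod.symm
    rw [e, h.tsum_eq]
  rw [tsum_congr key, tsum_mul_left]
  ring

/-- [folklore] **… SPLIT INTO THE THREE CELL-AND-LATTICE SUMS** when each word is summable in the lattice bond `u′` (for the two exchange words on the Wilson sector this is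
`ExchangeSlotLiteral.hasSum_literal_slot`; in general it is a hypothesis here):
`zmode N b̃_j (μ,ν; inl α, inl β) = c·(−(s_f s_m σ_j)²·Lc²)·( Σ_{u∈box N} Σ'_{u′} FF[direct] + Σ_{u∈box N} Σ'_{u′} FF[swap] − Σ_{u∈box N} Σ'_{u′} FF[W] )`. -/
theorem zmode_dressedSource_inl_inl_of_summable (hLc : 1 ≤ Lc) (hr : r ∈ box (d + 1) Lc) (sf sm : ℝ) (j : ℕ)
    {S M : Fin (d + 1) → Site (d + 1) → MKer (d + 1) (Fib d)}
    {W : Fin (d + 1) → Site (d + 1) → Fin (d + 1) → Site (d + 1) → MKer (d + 1) (Fib d)} {B : Tab d} (c cB : ℝ)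
    (hb : ∀ (κ : Fin (d + 1)) (y : Site (d + 1)), Loc (dM (unitK sf sm (coDressKBmAt (toSite r) Lc (KInvStep (d := d) Lc j))) Lc S M κ y))
    (hW : ∀ (κ : Fin (d + 1)) (y : Site (d + 1)) (κ' : Fin (d + 1)) (y' : Site (d + 1)), Loc (W κ y κ' y'))
    (hBff : ∀ κ u κ' u' x z (α β : Fin (d + 1)), B κ u κ' u' x z (Sum.inl α) (Sum.inl β) = 0) (N : ℕ) (μ ν α β : Fin (d + 1))
    (h1 : ∀ u : Site (d + 1), Summable fun u' : Site (d + 1) => ∑' yw : Site (d + 1) × Site (d + 1),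
        (if yw.1 α % (Lc : ℤ) = (Lc : ℤ) - 1 then (1 : ℝ) else 0) * (if yw.2 β % (Lc : ℤ) = (Lc : ℤ) - 1 then (1 : ℝ) else 0) *
        comp (comp (dM (unitK sf sm (coDressKBmAt (toSite r) Lc (KInvStep (d := d) Lc j))) Lc S M μ u)
          (unitK sf sm (coDressKBmAt (toSite r) Lc (KInvStep (d := d) Lc j))))
          (dM (unitK sf sm (coDressKBmAt (toSite r) Lc (KInvStep (d := d) Lc j))) Lc S M ν u') yw.1 yw.2 (Sum.inl α) (Sum.inl β))
    (h2 : ∀ u : Site (d + 1), Summable fun u' : Site (d + 1) => ∑' yw : Site (d + 1) × Site (d + 1),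
        (if yw.1 α % (Lc : ℤ) = (Lc : ℤ) - 1 then (1 : ℝ) else 0) * (if yw.2 β % (Lc : ℤ) = (Lc : ℤ) - 1 then (1 : ℝ) else 0) *
        comp (comp (dM (unitK sf sm (coDressKBmAt (toSite r) Lc (KInvStep (d := d) Lc j))) Lc S M ν u')
          (unitK sf sm (coDressKBmAt (toSite r) Lc (KInvStep (d := d) Lc j))))
          (dM (unitK sf sm (coDressKBmAt (toSite r) Lc (KInvStep (d := d) Lc j))) Lc S M μ u) yw.1 yw.2 (Sum.inl α) (Sum.inl β))
    (h3 : ∀ u : Site (d + 1), Summable fun u' : Site (d + 1) => ∑' yw : Site (d + 1) × Site (d + 1),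
        (if yw.1 α % (Lc : ℤ) = (Lc : ℤ) - 1 then (1 : ℝ) else 0) * (if yw.2 β % (Lc : ℤ) = (Lc : ℤ) - 1 then (1 : ℝ) else 0) *
        W μ u ν u' yw.1 yw.2 (Sum.inl α) (Sum.inl β)) :
    zmode N (fun κ u κ' u' => c • mmRead Lc (K3OfK (unitK sf sm (coDressKBmAt (toSite r) Lc (KInvStep (d := d) Lc j))) Lc S M W κ u κ' u') + cB • B κ u κ' u')
        μ ν (Sum.inl α) (Sum.inl β) =
      c * (-((sf * sm * ((((Lc ^ (j + 1) : ℕ) : ℝ)) ^ (d + 1 + 1))⁻¹) * (sf * sm * ((((Lc ^ (j + 1) : ℕ) : ℝ)) ^ (d + 1 + 1))⁻¹)) * ((Lc : ℝ) * (Lc : ℝ))) *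
        ((∑ u ∈ box (d + 1) N, ∑' u' : Site (d + 1), ∑' yw : Site (d + 1) × Site (d + 1),
              (if yw.1 α % (Lc : ℤ) = (Lc : ℤ) - 1 then (1 : ℝ) else 0) * (if yw.2 β % (Lc : ℤ) = (Lc : ℤ) - 1 then (1 : ℝ) else 0) *
              comp (comp (dM (unitK sf sm (coDressKBmAt (toSite r) Lc (KInvStep (d := d) Lc j))) Lc S M μ (toSite u))
                (unitK sf sm (coDressKBmAt (toSite r) Lc (KInvStep (d := d) Lc j))))
                (dM (unitK sf sm (coDressKBmAt (toSite r) Lc (KInvStep (d := d) Lc j))) Lc S M ν u') yw.1 yw.2 (Sum.inl α) (Sum.inl β)) +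
          (∑ u ∈ box (d + 1) N, ∑' u' : Site (d + 1), ∑' yw : Site (d + 1) × Site (d + 1),
              (if yw.1 α % (Lc : ℤ) = (Lc : ℤ) - 1 then (1 : ℝ) else 0) * (if yw.2 β % (Lc : ℤ) = (Lc : ℤ) - 1 then (1 : ℝ) else 0) *
              comp (comp (dM (unitK sf sm (coDressKBmAt (toSite r) Lc (KInvStep (d := d) Lc j))) Lc S M ν u')
                (unitK sf sm (coDressKBmAt (toSite r) Lc (KInvStep (d := d) Lc j))))
                (dM (unitK sf sm (coDressKBmAt (toSite r) Lc (KInvStep (d := d) Lc j))) Lc S M μ (toSite u)) yw.1 yw.2 (Sum.inl α) (Sum.inl β)) -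
          ∑ u ∈ box (d + 1) N, ∑' u' : Site (d + 1), ∑' yw : Site (d + 1) × Site (d + 1),
              (if yw.1 α % (Lc : ℤ) = (Lc : ℤ) - 1 then (1 : ℝ) else 0) * (if yw.2 β % (Lc : ℤ) = (Lc : ℤ) - 1 then (1 : ℝ) else 0) *
              W μ (toSite u) ν u' yw.1 yw.2 (Sum.inl α) (Sum.inl β)) := by
  rw [zmode_dressedSource_inl_inl hLc hr sf sm j c cB hb hW hBff N μ ν α β, ← Finset.sum_add_distrib, ← Finset.sum_sub_distrib]
  congr 1
  refine Finset.sum_congr rfl fun u _ => ?_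
  rw [← (h1 (toSite u)).tsum_add (h2 (toSite u)), ← ((h1 (toSite u)).add (h2 (toSite u))).tsum_sub (h3 (toSite u))]

end Summit.QuantumFields.BalabanUV.Beta.GAN24.DressedSourceZeroModeWords

end
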